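import Summits.BirchSwinnertonDyer.BirchSwinnertonDyer.Theorems.ByReductionTypeAtTwoFineSelmerConjAAtTwoAdditivePotGoodAscentStampsA
import HarnessLib

/-!
# C4″ `AdditivePotMultOverKAtTwo` (item stmt-BirchSwinnertonDyer-22618), the (I1M′) input of the upper half on the `Δ < 0` rows:
# KERNEL STAMPS, part E — Iwasawa's `μ₂ = 0` (ZERO hypotheses) for the `2`-torsion cubic fields `d = -424`, `d = -680` and UNCONDITIONAL
# statement (A) at `2` for the C4″ census curves 451136bl1, 59840t1

Cell `bsd-2adic`, rung K4, seat `bsd-2adic-k4-w3` GEN 11 (explicit unit of director-bsd g16 (309)(7); `--supports stmt-BirchSwinnertonDyer-22618`).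
HONEST FRAMING (D-0036/D-0054/D-0152): THEOREMS ONLY (no definition, no named fact, no `sorry`). FIELD PART (unconditional kernel arithmetic about an
explicit cubic field `ℚ(θ)`; generator = eng-2's polredabs cubic when its index `[𝓞 : ℤ[θ]]` is odd, else an odd-index second generator):
`irreducible_cubic_<d>`, `odd_classNumber_of_root_<d>` (norm certificate below the Minkowski bound; k4-w1's `odd_classNumber_of_cubeCertificate`),
**`classicalMu_two_cubicField_<d>`** = `μ = 0` (growth form) along EVERY cyclotomic `ℤ₂`-extension of `ℚ(θ)` from `e₀ = 0` (odd `h`), `e₁ = 0` (k4-w1's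
Chevalley door at `2`, `layerOneBit_of_chevalleyCert`: a unit with `2`-adic image `≡ ±3 (mod 8)` is not a norm from `ℚ(θ, √2)`; ≤ 2 primes above `2`),
`n₀ = 0` (odd cubic discriminant `…_of_odd_cubic_discr`, or `2 = 𝔭𝔮²` with an even-index certificate `…_of_evenIndexCertificate`) and Fukuda 1994 Thm. 1 (1)
(`_holds`). These fields have TWO primes above `2` (the `2`-division cubic of a potentially multiplicative curve has a `ℚ₂`-root). ROW PART:
`conjA_two_<L>'` = Coates–Sujatha's statement (A) at `p = 2` for the census cubic model of the Cremona class (a-invariants of addL2x GEN 13's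
`nst_census-j313647.tsv`), PROVED OUTRIGHT: field identification `ℚ(β) = ℚ(θ)` + cruxlead-19573-w2's door
`TotallyComplexMu.conjA_two_cubicModel_of_classicalMu_of_discr_neg` (kernel Lim 3.5@2 + `ℓ = 2` ascent). Certificates (norm witnesses, fundamental units by a
relation sieve, Hensel data, even-index elements) found by the seat's exact-arithmetic tools (`work/tools/`) and CHECKED HERE by the kernel; eng-2's
census CERT-ADD-POTMULT-FUKUDA269-E2 agrees (`μ₂ = λ₂ = 0`, bnfcertify). Statement (A) is NOT BSD: BSD₂ for these curves is not proved; C4″ / (I1M′) stay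
research-open; nothing booked; no row of 22618 changes tier (pen RC-490 (4)). Pattern/toolkit: k4-w1 GEN 5–8 (`…MuTwoKernelRows{A,B}`, `…AscentStampsA`).

References: [CoatesSujatha2005] Conj. A, Thm. 3.4; [Iwasawa1973MuInvariants] Thm. 2/3; [Fukuda1994] Thm. 1 (1); [Lang1990] Ch. 13 §4 Lemma 4.1;
[Washington1997] §13.1; [Marcus1977] Ch. 5 Thm. 35–37; [Cohen1993] §6.3; [Lim2017FineSelmer] §3; cell files `eng2/fukuda269/{TABLE,LAYERS}-…-E2-v1.tsv`.
-/

set_option autoImplicit false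
-- sibling precedent (`…MuTwoKernelRowsA.lean`): the directory name repeats the summit name
set_option linter.dupNamespace false

noncomputable section
open scoped Classical IntermediateField NumberField Real nonZeroDivisors
namespace Summit.BirchSwinnertonDyer.BirchSwinnertonDyer.Theorems.AddKatoTwo
open WeierstrassCurve Field Polynomial IsDedekindDomain NumberField Matrix Literature.NumberTheory.EllipticCurves
  Literature.NumberTheory.GaloisRepresentations
  Literature.NumberTheory.IwasawaTheory
  Summit.BirchSwinnertonDyer.BirchSwinnertonDyer.Theorems.SteinbergFibreAtTwo
  Summit.BirchSwinnertonDyer.BirchSwinnertonDyer.Theorems.AlignedTransportAtTwoTorsionPointField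
  Summit.BirchSwinnertonDyer.BirchSwinnertonDyer.Theses.ByReductionTypeAtTwo

/-! ## The cubic field of discriminant `-424` (`X³ + (-1)X² + (-14)X + (26)`, index `1`; C4″ rows 451136bl1) -/

/-- `X³ + (-1)X² + (-14)X + (26)` is irreducible over `ℚ` (no root mod `5`). -/
theorem irreducible_cubic_d424n : Irreducible (Cubic.toPoly ⟨1, ((-1 : ℤ) : ℚ), ((-14 : ℤ) : ℚ), ((26 : ℤ) : ℚ)⟩) :=
  haveI : Fact (Nat.Prime 5) := ⟨by norm_num⟩
  irreducible_cubic_of_no_root_zmod 5 (by decide)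

section Certd424n

variable (K : Type) [Field K] [NumberField K]

/-- **`h` is ODD for every cubic number field whose integers contain a root `θ` of `X³ + (-1)X² + (-14)X + (26)`** (`|disc| = 424` = `|d_K|`,
`M_K < 6`): a norm certificate — for every prime `ℓ < 6` and every root `a` of the cubic mod `ℓ` a generator `x + yθ + zθ² ∈ ℤ[θ]` of norm `±ℓ`
of the ideal `I ∋ ℓ, θ − a` (coordinates `(x, y, z)`: `ℓ = 2`: `a = 0` ↦ `(2, -1, 0)`, `a = 1` ↦ `(3, -1, 0)`; `ℓ = 3`: `a = 1` ↦ `(5, -2, 0)`; `ℓ = 5`: no root); found by the seat's relation sieve and CHECKED HERE by the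
kernel (`pow_three_eq_span_of_cert`, `Or.inl`). eng-2's PARI value (bnfcertify): `h = 1`. KERNEL. [cite: Marcus1977, Ch. 5 Thm. 35–37 and Cor. 2] [cite: Cohen1993, §6.3] -/
theorem odd_classNumber_of_root_d424n (h3 : Module.finrank ℚ K = 3) (b : 𝓞 K)
    (hb : b ^ 3 + (-1 : ℤ) * b ^ 2 + (-14 : ℤ) * b + (26 : ℤ) = 0) : Odd (NumberField.classNumber K) := by
  have hirr := irreducible_cubic_d424n
  have hd : |NumberField.discr K| ≤ (424 : ℕ) :=
    (abs_discr_le_abs_cubic_discr K h3 b hirr hb).trans (by simp only [Cubic.discr]; norm_num)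
  refine odd_classNumber_of_cubeCertificate K h3 (B := 6)
    (minkowskiBound_lt_of_sqrt_le K h3 hd (s := 20.60)
      ((Real.sqrt_le_sqrt (by norm_num : ((424 : ℕ) : ℝ) ≤ (20.60 : ℝ) ^ 2)).trans (Real.sqrt_sq (by norm_num)).le)
      (by norm_num)) ?_
  intro ℓ hℓB hℓ J hJ
  interval_cases ℓ <;> norm_num at hℓ
  · -- `ℓ = 2`: roots [0, 1]
    refine pow_three_eq_span_of_cert K h3 b hirr hb (by norm_num) (fun a ha hdvd => ?_) hJ
    interval_cases a <;> norm_num at hdvd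
    · exact Or.inl ⟨(2), (-1), (0), 1, by norm_num, by norm_num, ⟨_, by rw [Nat.cast_one, one_mul]⟩, by norm_num⟩
    · exact Or.inl ⟨(3), (-1), (0), 1, by norm_num, by norm_num, ⟨_, by rw [Nat.cast_one, one_mul]⟩, by norm_num⟩
  · -- `ℓ = 3`: roots [1]
    refine pow_three_eq_span_of_cert K h3 b hirr hb (by norm_num) (fun a ha hdvd => ?_) hJ
    interval_cases a <;> norm_num at hdvd
    · exact Or.inl ⟨(5), (-2), (0), 1, by norm_num, by norm_num, ⟨_, by rw [Nat.cast_one, one_mul]⟩, by norm_num⟩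
  · -- `ℓ = 5`: roots []
    refine pow_three_eq_span_of_cert K h3 b hirr hb (by norm_num) (fun a ha hdvd => ?_) hJ
    interval_cases a <;> norm_num at hdvd

end Certd424n

/-- **Iwasawa's `μ₂ = 0` for the cubic field of discriminant `-424`** (`ℚ(θ)`, `θ³ + (-1)θ² + (-14)θ + (26) = 0`; TWO primes above `2`,
`2 = 𝔭𝔮²`; `h` odd), KERNEL — every cyclotomic `ℤ₂`-extension of `ℚ(θ)` has `μ = 0` (growth form; indeed `e_n = 0` for all `n`).
Chevalley's door at `2` (k4-w1 `layerOneBit_of_chevalleyCert`): the unit `ε = (-19) + (15)θ + (-3)θ²` (regulator ≈ 4.86;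
`ε³ + (129)ε² + (21)ε + (1) = 0`) has `ε ≡ 5 (mod 8)` under `θ ↦ z₂ ≡ 5` (`8 ∣ g(5)`, `g'(5)` odd), so `(ε, 2)_𝔭 = −1`: a non-norm
from `ℚ(θ, √2)`, whence `e₁ = 0`; `≤ 2` primes above `2` by `4 ∤ g(0)`, `4 ∤ g(3)`; `e₀ = 0` by `odd_classNumber_of_root_d424n`; `n₀ = 0` by an even-index certificate `u, v, m, m'` (`u² − 2v² = 4m`, `m² = 2m'`, `8 ∤ N(2 − m'³)`; `classicalMuVanishes_two_adjoin_of_evenIndexCertificate`); Fukuda 1994 Thm. 1 (1) (`_holds`).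
The (I1M′) input of GEN 9's door for the C4″ rows 451136bl1. [cite: Fukuda1994, Thm. 1 (1), p. 264] [cite: Lang1990, Ch. 13 §4, Lemma 4.1]
[cite: Washington1997, §13.1] [cite: Greenberg2001IwasawaPastPresent, §4 (Iwasawa's μ-conjecture)] -/
theorem classicalMu_two_cubicField_d424n {θ : AlgebraicClosure ℚ} (hθ : aeval θ (Cubic.toPoly ⟨1, ((-1 : ℤ) : ℚ), ((-14 : ℤ) : ℚ), ((26 : ℤ) : ℚ)⟩) = 0) :
    haveI : FiniteDimensional ℚ (IntermediateField.adjoin ℚ {θ}) :=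
      IntermediateField.adjoin.finiteDimensional ((AlgebraicClosure.isAlgebraic ℚ).isAlgebraic θ).isIntegral
    haveI : NumberField (IntermediateField.adjoin ℚ {θ}) := NumberField.mk
    ∀ κL : ZpExtension (IntermediateField.adjoin ℚ {θ}) 2, κL.IsCyclotomic → ClassicalMuVanishes κL := by
  intro κL hκL
  have hθ' : θ ^ 3 + (-1 : AlgebraicClosure ℚ) * θ ^ 2 + (-14 : AlgebraicClosure ℚ) * θ + (26 : AlgebraicClosure ℚ) = 0 := by
    have := hθ
    simp only [Cubic.toPoly, map_one, one_mul, aeval_add, aeval_mul, aeval_C, aeval_X_pow, aeval_X,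
      eq_ratCast, Rat.cast_intCast] at this
    push_cast at this
    linear_combination this
  have he : aeval (algebraMap ℚ (AlgebraicClosure ℚ) (((-19 : ℤ) : ℚ) / ((1 : ℤ) : ℚ)) +
      algebraMap ℚ (AlgebraicClosure ℚ) (((15 : ℤ) : ℚ) / ((1 : ℤ) : ℚ)) * θ +
      algebraMap ℚ (AlgebraicClosure ℚ) (((-3 : ℤ) : ℚ) / ((1 : ℤ) : ℚ)) * θ ^ 2)
      (Cubic.toPoly ⟨1, ((129 : ℤ) : ℚ), ((21 : ℤ) : ℚ), ((1 : ℤ) : ℚ)⟩) = 0 := by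
    simp only [Cubic.toPoly, map_one, one_mul, aeval_add, aeval_mul, aeval_C, aeval_X_pow, aeval_X, eq_ratCast,
      Rat.cast_intCast, Rat.cast_div]
    push_cast
    linear_combination ((1512 : AlgebraicClosure ℚ) + (-1377 : AlgebraicClosure ℚ) * θ + (378 : AlgebraicClosure ℚ) * θ ^ 2 + (-27 : AlgebraicClosure ℚ) * θ ^ 3) * hθ'
  have hh := not_two_dvd_card_classGroup_adjoin_of_forall_cubicField_odd irreducible_cubic_d424n (odd_classNumber_of_root_d424n) hθ
  have h1 := layerOneBit_of_chevalleyCert irreducible_cubic_d424n hθ hh ⟨0, by norm_num⟩ ⟨1, by norm_num⟩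
      (-19) (15) (-3) (1) (129) (21) (1) (by norm_num) he (5) (1) (by norm_num) (by norm_num) (by decide) (by decide)
  have hirr := irreducible_cubic_d424n
  haveI : FiniteDimensional ℚ (IntermediateField.adjoin ℚ {θ}) :=
    IntermediateField.adjoin.finiteDimensional ((AlgebraicClosure.isAlgebraic ℚ).isAlgebraic θ).isIntegral
  haveI : NumberField (IntermediateField.adjoin ℚ {θ}) := NumberField.mk
  obtain ⟨B, -, hB⟩ := exists_ringOfIntegers_cubic_root (p := -1) (q := -14) (r := 26) hθ
  have h3 := finrank_adjoin_eq_three_of_irreducible hirr hθ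
  refine classicalMuVanishes_two_adjoin_of_evenIndexCertificate (p := -1) (q := -14) (r := 26) hirr hθ
    (((0 : ℤ) : 𝓞 (IntermediateField.adjoin ℚ {θ})) + ((-1 : ℤ) : 𝓞 (IntermediateField.adjoin ℚ {θ})) * B + ((1 : ℤ) : 𝓞 (IntermediateField.adjoin ℚ {θ})) * B ^ 2) (((-1 : ℤ) : 𝓞 (IntermediateField.adjoin ℚ {θ})) + ((-1 : ℤ) : 𝓞 (IntermediateField.adjoin ℚ {θ})) * B + ((0 : ℤ) : 𝓞 (IntermediateField.adjoin ℚ {θ})) * B ^ 2) (((6 : ℤ) : 𝓞 (IntermediateField.adjoin ℚ {θ})) + ((-11 : ℤ) : 𝓞 (IntermediateField.adjoin ℚ {θ})) * B + ((3 : ℤ) : 𝓞 (IntermediateField.adjoin ℚ {θ})) * B ^ 2) (((759 : ℤ) : 𝓞 (IntermediateField.adjoin ℚ {θ})) + ((-582 : ℤ) : 𝓞 (IntermediateField.adjoin ℚ {θ})) * B + ((113 : ℤ) : 𝓞 (IntermediateField.adjoin ℚ {θ})) * B ^ 2) ?_ ?_ ?_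
    hh κL hκL (h1 κL hκL)
  · push_cast; linear_combination (((-1 : ℤ) : 𝓞 (IntermediateField.adjoin ℚ {θ})) + ((1 : ℤ) : 𝓞 (IntermediateField.adjoin ℚ {θ})) * B + ((0 : ℤ) : 𝓞 (IntermediateField.adjoin ℚ {θ})) * B ^ 2) * hB
  · push_cast; linear_combination (((-57 : ℤ) : 𝓞 (IntermediateField.adjoin ℚ {θ})) + ((9 : ℤ) : 𝓞 (IntermediateField.adjoin ℚ {θ})) * B + ((0 : ℤ) : 𝓞 (IntermediateField.adjoin ℚ {θ})) * B ^ 2) * hB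
  · have hz : (2 : 𝓞 (IntermediateField.adjoin ℚ {θ})) - (((759 : ℤ) : 𝓞 (IntermediateField.adjoin ℚ {θ})) + ((-582 : ℤ) : 𝓞 (IntermediateField.adjoin ℚ {θ})) * B + ((113 : ℤ) : 𝓞 (IntermediateField.adjoin ℚ {θ})) * B ^ 2) ^ 3 =
        ((-18190687729 : ℤ) : 𝓞 (IntermediateField.adjoin ℚ {θ})) + (14289915234 : ℤ) * B + (-2831404727 : ℤ) * B ^ 2 := by
      push_cast; linear_combination (((682824702 : ℤ) : 𝓞 (IntermediateField.adjoin ℚ {θ})) + ((-143251230 : ℤ) : 𝓞 (IntermediateField.adjoin ℚ {θ})) * B + ((20851777 : ℤ) : 𝓞 (IntermediateField.adjoin ℚ {θ})) * B ^ 2 + ((-1442897 : ℤ) : 𝓞 (IntermediateField.adjoin ℚ {θ})) * B ^ 3 + ((0 : ℤ) : 𝓞 (IntermediateField.adjoin ℚ {θ})) * B ^ 4) * hB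
    rw [hz]
    exact not_eight_dvd_norm_coords _ h3 B hirr hB (-18190687729) (14289915234) (-2831404727) (N := -1003200985641318)
      (by simp only [Matrix.one_fin_three, Matrix.det_fin_three, Matrix.add_apply, Matrix.smul_apply, sq, Matrix.mul_apply,
        Fin.sum_univ_three, Matrix.of_apply, Matrix.cons_val', Matrix.cons_val_zero, Matrix.cons_val_one, Matrix.cons_val_two,
        Matrix.head_cons, Matrix.tail_cons, Matrix.empty_val', Matrix.cons_val_fin_one, smul_eq_mul]; norm_num) (by norm_num)

/-! ### Row `451136bl1` (cubic field `d = -424`) -/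

/-- The census cubic model of the C4″ row `451136bl1` (`y² = x³ + (-1)x² + (-11183009)x + (-14391337663)`, addL2x GEN 13 `nst_census` a-invariants) is an elliptic curve. -/
theorem isElliptic_451136bl1' : (⟨0, ((-1 : ℤ) : ℚ), 0, ((-11183009 : ℤ) : ℚ), ((-14391337663 : ℤ) : ℚ)⟩ : WeierstrassCurve ℚ).IsElliptic :=
  isElliptic_cubicModel _ _ _ (by simp only [Cubic.discr]; norm_num)

/-- **UNCONDITIONAL (A)₂ for the C4″ census curve `451136bl1` — ZERO hypotheses, ZERO named facts** (additive potentially multiplicative at `2`,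
irreducible `E[2]`, `Δ < 0`; `2`-torsion cubic field `ℚ(θ)`, `θ³ + (-1)θ² + (-14)θ + (26) = 0`, `d = -424`, `p q^2, F_q=Q2(sqrt6)`, `h` odd). Coates–Sujatha's
statement (A) at `p = 2` for the cubic model `y² = x³ + (-1)x² + (-11183009)x + (-14391337663)`: for every cyclotomic `ℤ₂`-extension of `ℚ` the dual fine Selmer group
over `ℚ_∞` is finitely generated over `ℤ₂` (`∃ γ D` currency). KERNEL: `classicalMu_two_cubicField_d424n` above (μ₂(ℚ(θ)_cyc) = 0 for the field of `X³ + (-1)X² + (-14)X + (26)`) ⟹ cruxlead-19573-w2's `ℓ = 2` ascent to the totally complex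
`ℚ(E[2]) = ℚ(θ, √d)` and kernel Lim 3.5@2 (`TotallyComplexMu.conjA_two_cubicModel_of_classicalMu_of_discr_neg`); the root `β = x(T)` of the curve's cubic is
`-1151 + (-664)θ + (142)θ²` and `ℚ(β) = ℚ(θ)`. This discharges the (I1M′) input of this row (GEN 9 `hAnaMI_negDisc_of_cubicFieldMu`) in the kernel;
it is statement (A), NOT BSD: BSD₂ for `451136bl1` is NOT proved by this. [cite: CoatesSujatha2005, Conj. A and Thm. 3.4]
[cite: Iwasawa1973MuInvariants, Thm. 2 and Thm. 3] [cite: Fukuda1994, Thm. 1 (1), p. 264] [cite: Lang1990, Ch. 13 §4, Lemma 4.1] -/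
theorem conjA_two_451136bl1' (κ : ZpExtension ℚ 2) (hκ : κ.IsCyclotomic) :
    haveI := isElliptic_451136bl1'
    ∃ (γ : absoluteGaloisGroup ℚ) (D : (⟨0, ((-1 : ℤ) : ℚ), 0, ((-11183009 : ℤ) : ℚ), ((-14391337663 : ℤ) : ℚ)⟩ : WeierstrassCurve ℚ).FineSelmerDualData κ γ),
      Module.Finite ℤ_[2] (RestrictScalars ℤ_[2] (IwasawaAlgebra 2) D.X) := by
  haveI := isElliptic_451136bl1'
  obtain ⟨θ, hθ⟩ : ∃ θ : AlgebraicClosure ℚ, aeval θ (Cubic.toPoly ⟨1, ((-1 : ℤ) : ℚ), ((-14 : ℤ) : ℚ), ((26 : ℤ) : ℚ)⟩) = 0 :=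
    IsAlgClosed.exists_aeval_eq_zero _ _ (by rw [Cubic.degree_of_a_ne_zero one_ne_zero]; norm_num)
  have hθ' : θ ^ 3 + (-1 : AlgebraicClosure ℚ) * θ ^ 2 + (-14 : AlgebraicClosure ℚ) * θ + (26 : AlgebraicClosure ℚ) = 0 := by
    have := hθ
    simp only [Cubic.toPoly, map_one, one_mul, aeval_add, aeval_mul, aeval_C, aeval_X_pow, aeval_X,
      eq_ratCast, Rat.cast_intCast] at this
    push_cast at this
    linear_combination this
  set β : AlgebraicClosure ℚ := algebraMap ℚ (AlgebraicClosure ℚ) (-1151 : ℚ) +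
      algebraMap ℚ (AlgebraicClosure ℚ) (-664 : ℚ) * θ + algebraMap ℚ (AlgebraicClosure ℚ) (142 : ℚ) * θ ^ 2 with hβdef
  have hβ : aeval β (Cubic.toPoly ⟨1, ((-1 : ℤ) : ℚ), ((-11183009 : ℤ) : ℚ), ((-14391337663 : ℤ) : ℚ)⟩) = 0 := by
    simp only [Cubic.toPoly, map_one, one_mul, aeval_add, aeval_mul, aeval_C, aeval_X_pow, aeval_X, eq_ratCast,
      Rat.cast_intCast]
    rw [hβdef]
    simp only [eq_ratCast]
    push_cast
    linear_combination ((-117148656 : AlgebraicClosure ℚ) + (120957872 : AlgebraicClosure ℚ) * θ + (-37303400 : AlgebraicClosure ℚ) * θ ^ 2 + (2863288 : AlgebraicClosure ℚ) * θ ^ 3) * hθ'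
  have hadj : IntermediateField.adjoin ℚ {β} = IntermediateField.adjoin ℚ {θ} := by
    apply le_antisymm
    · rw [IntermediateField.adjoin_simple_le_iff, hβdef]
      have hθmem := IntermediateField.mem_adjoin_simple_self ℚ θ
      exact add_mem (add_mem (algebraMap_mem _ _) (mul_mem (algebraMap_mem _ _) hθmem))
        (mul_mem (algebraMap_mem _ _) (pow_mem hθmem 2))
    · rw [IntermediateField.adjoin_simple_le_iff]
      have hθeq : θ = algebraMap ℚ (AlgebraicClosure ℚ) (536103571/20437312 : ℚ) +
          algebraMap ℚ (AlgebraicClosure ℚ) (28487/5109328 : ℚ) * β +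
          algebraMap ℚ (AlgebraicClosure ℚ) (-71/20437312 : ℚ) * β ^ 2 := by
        rw [hβdef]; simp only [eq_ratCast]; push_cast
        linear_combination (((-2989313 : AlgebraicClosure ℚ) / 5109328) + ((357911 : AlgebraicClosure ℚ) / 5109328) * θ) * hθ'
      rw [hθeq]
      have hβmem := IntermediateField.mem_adjoin_simple_self ℚ β
      exact add_mem (add_mem (algebraMap_mem _ _) (mul_mem (algebraMap_mem _ _) hβmem))
        (mul_mem (algebraMap_mem _ _) (pow_mem hβmem 2))
  have h3 : Module.finrank ℚ (IntermediateField.adjoin ℚ {β}) = 3 := by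
    rw [hadj]; exact finrank_adjoin_eq_three_of_irreducible irreducible_cubic_d424n hθ
  exact TotallyComplexMu.conjA_two_cubicModel_of_classicalMu_of_discr_neg (-1) (-11183009) (-14391337663)
    (irreducible_cubic_of_finrank_adjoin_eq_three hβ h3) (by simp only [Cubic.discr]; norm_num) hβ
    (by rw [hadj]; exact classicalMu_two_cubicField_d424n hθ) κ hκ

/-! ## The cubic field of discriminant `-680` (`X³ + (-1)X² + (-6)X + (10)`, index `1`; C4″ rows 59840t1) -/

/-- `X³ + (-1)X² + (-6)X + (10)` is irreducible over `ℚ` (no root mod `3`). -/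
theorem irreducible_cubic_d680n : Irreducible (Cubic.toPoly ⟨1, ((-1 : ℤ) : ℚ), ((-6 : ℤ) : ℚ), ((10 : ℤ) : ℚ)⟩) :=
  haveI : Fact (Nat.Prime 3) := ⟨by norm_num⟩
  irreducible_cubic_of_no_root_zmod 3 (by decide)

section Certd680n

variable (K : Type) [Field K] [NumberField K]

/-- **`h` is ODD for every cubic number field whose integers contain a root `θ` of `X³ + (-1)X² + (-6)X + (10)`** (`|disc| = 680` = `|d_K|`,
`M_K < 8`): a norm certificate — for every prime `ℓ < 8` and every root `a` of the cubic mod `ℓ` a generator `x + yθ + zθ² ∈ ℤ[θ]` of norm `±ℓ`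
of the ideal `I ∋ ℓ, θ − a` (coordinates `(x, y, z)`: `ℓ = 2`: `a = 0` ↦ `(2, -1, 0)`, `a = 1` ↦ `(7, -7, 2)`; `ℓ = 3`: no root; `ℓ = 5`: `a = 0` ↦ `(5, -1, -1)`, `a = 3` ↦ `(9, -2, -2)`; `ℓ = 7`: `a = 6` ↦ `(3, -3, 1)`); found by the seat's relation sieve and CHECKED HERE by the
kernel (`pow_three_eq_span_of_cert`, `Or.inl`). eng-2's PARI value (bnfcertify): `h = 1`. KERNEL. [cite: Marcus1977, Ch. 5 Thm. 35–37 and Cor. 2] [cite: Cohen1993, §6.3] -/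
theorem odd_classNumber_of_root_d680n (h3 : Module.finrank ℚ K = 3) (b : 𝓞 K)
    (hb : b ^ 3 + (-1 : ℤ) * b ^ 2 + (-6 : ℤ) * b + (10 : ℤ) = 0) : Odd (NumberField.classNumber K) := by
  have hirr := irreducible_cubic_d680n
  have hd : |NumberField.discr K| ≤ (680 : ℕ) :=
    (abs_discr_le_abs_cubic_discr K h3 b hirr hb).trans (by simp only [Cubic.discr]; norm_num)
  refine odd_classNumber_of_cubeCertificate K h3 (B := 8)
    (minkowskiBound_lt_of_sqrt_le K h3 hd (s := 26.08)
      ((Real.sqrt_le_sqrt (by norm_num : ((680 : ℕ) : ℝ) ≤ (26.08 : ℝ) ^ 2)).trans (Real.sqrt_sq (by norm_num)).le)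
      (by norm_num)) ?_
  intro ℓ hℓB hℓ J hJ
  interval_cases ℓ <;> norm_num at hℓ
  · -- `ℓ = 2`: roots [0, 1]
    refine pow_three_eq_span_of_cert K h3 b hirr hb (by norm_num) (fun a ha hdvd => ?_) hJ
    interval_cases a <;> norm_num at hdvd
    · exact Or.inl ⟨(2), (-1), (0), 1, by norm_num, by norm_num, ⟨_, by rw [Nat.cast_one, one_mul]⟩, by norm_num⟩
    · exact Or.inl ⟨(7), (-7), (2), 1, by norm_num, by norm_num, ⟨_, by rw [Nat.cast_one, one_mul]⟩, by norm_num⟩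
  · -- `ℓ = 3`: roots []
    refine pow_three_eq_span_of_cert K h3 b hirr hb (by norm_num) (fun a ha hdvd => ?_) hJ
    interval_cases a <;> norm_num at hdvd
  · -- `ℓ = 5`: roots [0, 3]
    refine pow_three_eq_span_of_cert K h3 b hirr hb (by norm_num) (fun a ha hdvd => ?_) hJ
    interval_cases a <;> norm_num at hdvd
    · exact Or.inl ⟨(5), (-1), (-1), 1, by norm_num, by norm_num, ⟨_, by rw [Nat.cast_one, one_mul]⟩, by norm_num⟩
    · exact Or.inl ⟨(9), (-2), (-2), 1, by norm_num, by norm_num, ⟨_, by rw [Nat.cast_one, one_mul]⟩, by norm_num⟩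
  · -- `ℓ = 7`: roots [6]
    refine pow_three_eq_span_of_cert K h3 b hirr hb (by norm_num) (fun a ha hdvd => ?_) hJ
    interval_cases a <;> norm_num at hdvd
    · exact Or.inl ⟨(3), (-3), (1), 1, by norm_num, by norm_num, ⟨_, by rw [Nat.cast_one, one_mul]⟩, by norm_num⟩

end Certd680n

/-- **Iwasawa's `μ₂ = 0` for the cubic field of discriminant `-680`** (`ℚ(θ)`, `θ³ + (-1)θ² + (-6)θ + (10) = 0`; TWO primes above `2`,
`2 = 𝔭𝔮²`; `h` odd), KERNEL — every cyclotomic `ℤ₂`-extension of `ℚ(θ)` has `μ = 0` (growth form; indeed `e_n = 0` for all `n`).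
Chevalley's door at `2` (k4-w1 `layerOneBit_of_chevalleyCert`): the unit `ε = (-79) + (77)θ + (-21)θ²` (regulator ≈ 6.07;
`ε³ + (433)ε² + (5)ε + (1) = 0`) has `ε ≡ 5 (mod 8)` under `θ ↦ z₂ ≡ 5` (`8 ∣ g(5)`, `g'(5)` odd), so `(ε, 2)_𝔭 = −1`: a non-norm
from `ℚ(θ, √2)`, whence `e₁ = 0`; `≤ 2` primes above `2` by `4 ∤ g(0)`, `4 ∤ g(3)`; `e₀ = 0` by `odd_classNumber_of_root_d680n`; `n₀ = 0` by an even-index certificate `u, v, m, m'` (`u² − 2v² = 4m`, `m² = 2m'`, `8 ∤ N(2 − m'³)`; `classicalMuVanishes_two_adjoin_of_evenIndexCertificate`); Fukuda 1994 Thm. 1 (1) (`_holds`).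
The (I1M′) input of GEN 9's door for the C4″ rows 59840t1. [cite: Fukuda1994, Thm. 1 (1), p. 264] [cite: Lang1990, Ch. 13 §4, Lemma 4.1]
[cite: Washington1997, §13.1] [cite: Greenberg2001IwasawaPastPresent, §4 (Iwasawa's μ-conjecture)] -/
theorem classicalMu_two_cubicField_d680n {θ : AlgebraicClosure ℚ} (hθ : aeval θ (Cubic.toPoly ⟨1, ((-1 : ℤ) : ℚ), ((-6 : ℤ) : ℚ), ((10 : ℤ) : ℚ)⟩) = 0) :
    haveI : FiniteDimensional ℚ (IntermediateField.adjoin ℚ {θ}) :=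
      IntermediateField.adjoin.finiteDimensional ((AlgebraicClosure.isAlgebraic ℚ).isAlgebraic θ).isIntegral
    haveI : NumberField (IntermediateField.adjoin ℚ {θ}) := NumberField.mk
    ∀ κL : ZpExtension (IntermediateField.adjoin ℚ {θ}) 2, κL.IsCyclotomic → ClassicalMuVanishes κL := by
  intro κL hκL
  have hθ' : θ ^ 3 + (-1 : AlgebraicClosure ℚ) * θ ^ 2 + (-6 : AlgebraicClosure ℚ) * θ + (10 : AlgebraicClosure ℚ) = 0 := by
    have := hθ
    simp only [Cubic.toPoly, map_one, one_mul, aeval_add, aeval_mul, aeval_C, aeval_X_pow, aeval_X,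
      eq_ratCast, Rat.cast_intCast] at this
    push_cast at this
    linear_combination this
  have he : aeval (algebraMap ℚ (AlgebraicClosure ℚ) (((-79 : ℤ) : ℚ) / ((1 : ℤ) : ℚ)) +
      algebraMap ℚ (AlgebraicClosure ℚ) (((77 : ℤ) : ℚ) / ((1 : ℤ) : ℚ)) * θ +
      algebraMap ℚ (AlgebraicClosure ℚ) (((-21 : ℤ) : ℚ) / ((1 : ℤ) : ℚ)) * θ ^ 2)
      (Cubic.toPoly ⟨1, ((433 : ℤ) : ℚ), ((5 : ℤ) : ℚ), ((1 : ℤ) : ℚ)⟩) = 0 := by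
    simp only [Cubic.toPoly, map_one, one_mul, aeval_add, aeval_mul, aeval_C, aeval_X_pow, aeval_X, eq_ratCast,
      Rat.cast_intCast, Rat.cast_div]
    push_cast
    linear_combination ((220892 : AlgebraicClosure ℚ) + (-250047 : AlgebraicClosure ℚ) * θ + (92610 : AlgebraicClosure ℚ) * θ ^ 2 + (-9261 : AlgebraicClosure ℚ) * θ ^ 3) * hθ'
  have hh := not_two_dvd_card_classGroup_adjoin_of_forall_cubicField_odd irreducible_cubic_d680n (odd_classNumber_of_root_d680n) hθ
  have h1 := layerOneBit_of_chevalleyCert irreducible_cubic_d680n hθ hh ⟨0, by norm_num⟩ ⟨1, by norm_num⟩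
      (-79) (77) (-21) (1) (433) (5) (1) (by norm_num) he (5) (1) (by norm_num) (by norm_num) (by decide) (by decide)
  have hirr := irreducible_cubic_d680n
  haveI : FiniteDimensional ℚ (IntermediateField.adjoin ℚ {θ}) :=
    IntermediateField.adjoin.finiteDimensional ((AlgebraicClosure.isAlgebraic ℚ).isAlgebraic θ).isIntegral
  haveI : NumberField (IntermediateField.adjoin ℚ {θ}) := NumberField.mk
  obtain ⟨B, -, hB⟩ := exists_ringOfIntegers_cubic_root (p := -1) (q := -6) (r := 10) hθ
  have h3 := finrank_adjoin_eq_three_of_irreducible hirr hθ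
  refine classicalMuVanishes_two_adjoin_of_evenIndexCertificate (p := -1) (q := -6) (r := 10) hirr hθ
    (((0 : ℤ) : 𝓞 (IntermediateField.adjoin ℚ {θ})) + ((-1 : ℤ) : 𝓞 (IntermediateField.adjoin ℚ {θ})) * B + ((1 : ℤ) : 𝓞 (IntermediateField.adjoin ℚ {θ})) * B ^ 2) (((-1 : ℤ) : 𝓞 (IntermediateField.adjoin ℚ {θ})) + ((-1 : ℤ) : 𝓞 (IntermediateField.adjoin ℚ {θ})) * B + ((0 : ℤ) : 𝓞 (IntermediateField.adjoin ℚ {θ})) * B ^ 2) (((2 : ℤ) : 𝓞 (IntermediateField.adjoin ℚ {θ})) + ((-5 : ℤ) : 𝓞 (IntermediateField.adjoin ℚ {θ})) * B + ((1 : ℤ) : 𝓞 (IntermediateField.adjoin ℚ {θ})) * B ^ 2) (((47 : ℤ) : 𝓞 (IntermediateField.adjoin ℚ {θ})) + ((-42 : ℤ) : 𝓞 (IntermediateField.adjoin ℚ {θ})) * B + ((13 : ℤ) : 𝓞 (IntermediateField.adjoin ℚ {θ})) * B ^ 2) ?_ ?_ ?_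
    hh κL hκL (h1 κL hκL)
  · push_cast; linear_combination (((-1 : ℤ) : 𝓞 (IntermediateField.adjoin ℚ {θ})) + ((1 : ℤ) : 𝓞 (IntermediateField.adjoin ℚ {θ})) * B + ((0 : ℤ) : 𝓞 (IntermediateField.adjoin ℚ {θ})) * B ^ 2) * hB
  · push_cast; linear_combination (((-9 : ℤ) : 𝓞 (IntermediateField.adjoin ℚ {θ})) + ((1 : ℤ) : 𝓞 (IntermediateField.adjoin ℚ {θ})) * B + ((0 : ℤ) : 𝓞 (IntermediateField.adjoin ℚ {θ})) * B ^ 2) * hB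
  · have hz : (2 : 𝓞 (IntermediateField.adjoin ℚ {θ})) - (((47 : ℤ) : 𝓞 (IntermediateField.adjoin ℚ {θ})) + ((-42 : ℤ) : 𝓞 (IntermediateField.adjoin ℚ {θ})) * B + ((13 : ℤ) : 𝓞 (IntermediateField.adjoin ℚ {θ})) * B ^ 2) ^ 3 =
        ((-2882841 : ℤ) : 𝓞 (IntermediateField.adjoin ℚ {θ})) + (2812846 : ℤ) * B + (-768203 : ℤ) * B ^ 2 := by
      push_cast; linear_combination (((277902 : ℤ) : 𝓞 (IntermediateField.adjoin ℚ {θ})) + ((-86710 : ℤ) : 𝓞 (IntermediateField.adjoin ℚ {θ})) * B + ((19097 : ℤ) : 𝓞 (IntermediateField.adjoin ℚ {θ})) * B ^ 2 + ((-2197 : ℤ) : 𝓞 (IntermediateField.adjoin ℚ {θ})) * B ^ 3 + ((0 : ℤ) : 𝓞 (IntermediateField.adjoin ℚ {θ})) * B ^ 4) * hB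
    rw [hz]
    exact not_eight_dvd_norm_coords _ h3 B hirr hB (-2882841) (2812846) (-768203) (N := -9534282992230)
      (by simp only [Matrix.one_fin_three, Matrix.det_fin_three, Matrix.add_apply, Matrix.smul_apply, sq, Matrix.mul_apply,
        Fin.sum_univ_three, Matrix.of_apply, Matrix.cons_val', Matrix.cons_val_zero, Matrix.cons_val_one, Matrix.cons_val_two,
        Matrix.head_cons, Matrix.tail_cons, Matrix.empty_val', Matrix.cons_val_fin_one, smul_eq_mul]; norm_num) (by norm_num)

/-! ### Row `59840t1` (cubic field `d = -680`) -/

/-- The census cubic model of the C4″ row `59840t1` (`y² = x³ + (0)x² + (-2357452)x + (-1393215376)`, addL2x GEN 13 `nst_census` a-invariants) is an elliptic curve. -/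
theorem isElliptic_59840t1' : (⟨0, ((0 : ℤ) : ℚ), 0, ((-2357452 : ℤ) : ℚ), ((-1393215376 : ℤ) : ℚ)⟩ : WeierstrassCurve ℚ).IsElliptic :=
  isElliptic_cubicModel _ _ _ (by simp only [Cubic.discr]; norm_num)

/-- **UNCONDITIONAL (A)₂ for the C4″ census curve `59840t1` — ZERO hypotheses, ZERO named facts** (additive potentially multiplicative at `2`,
irreducible `E[2]`, `Δ < 0`; `2`-torsion cubic field `ℚ(θ)`, `θ³ + (-1)θ² + (-6)θ + (10) = 0`, `d = -680`, `p q^2, F_q=Q2(sqrt6)`, `h` odd). Coates–Sujatha's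
statement (A) at `p = 2` for the cubic model `y² = x³ + (0)x² + (-2357452)x + (-1393215376)`: for every cyclotomic `ℤ₂`-extension of `ℚ` the dual fine Selmer group
over `ℚ_∞` is finitely generated over `ℤ₂` (`∃ γ D` currency). KERNEL: `classicalMu_two_cubicField_d680n` above (μ₂(ℚ(θ)_cyc) = 0 for the field of `X³ + (-1)X² + (-6)X + (10)`) ⟹ cruxlead-19573-w2's `ℓ = 2` ascent to the totally complex
`ℚ(E[2]) = ℚ(θ, √d)` and kernel Lim 3.5@2 (`TotallyComplexMu.conjA_two_cubicModel_of_classicalMu_of_discr_neg`); the root `β = x(T)` of the curve's cubic is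
`-406 + (-472)θ + (130)θ²` and `ℚ(β) = ℚ(θ)`. This discharges the (I1M′) input of this row (GEN 9 `hAnaMI_negDisc_of_cubicFieldMu`) in the kernel;
it is statement (A), NOT BSD: BSD₂ for `59840t1` is NOT proved by this. [cite: CoatesSujatha2005, Conj. A and Thm. 3.4]
[cite: Iwasawa1973MuInvariants, Thm. 2 and Thm. 3] [cite: Fukuda1994, Thm. 1 (1), p. 264] [cite: Lang1990, Ch. 13 §4, Lemma 4.1] -/
theorem conjA_two_59840t1' (κ : ZpExtension ℚ 2) (hκ : κ.IsCyclotomic) :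
    haveI := isElliptic_59840t1'
    ∃ (γ : absoluteGaloisGroup ℚ) (D : (⟨0, ((0 : ℤ) : ℚ), 0, ((-2357452 : ℤ) : ℚ), ((-1393215376 : ℤ) : ℚ)⟩ : WeierstrassCurve ℚ).FineSelmerDualData κ γ),
      Module.Finite ℤ_[2] (RestrictScalars ℤ_[2] (IwasawaAlgebra 2) D.X) := by
  haveI := isElliptic_59840t1'
  obtain ⟨θ, hθ⟩ : ∃ θ : AlgebraicClosure ℚ, aeval θ (Cubic.toPoly ⟨1, ((-1 : ℤ) : ℚ), ((-6 : ℤ) : ℚ), ((10 : ℤ) : ℚ)⟩) = 0 :=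
    IsAlgClosed.exists_aeval_eq_zero _ _ (by rw [Cubic.degree_of_a_ne_zero one_ne_zero]; norm_num)
  have hθ' : θ ^ 3 + (-1 : AlgebraicClosure ℚ) * θ ^ 2 + (-6 : AlgebraicClosure ℚ) * θ + (10 : AlgebraicClosure ℚ) = 0 := by
    have := hθ
    simp only [Cubic.toPoly, map_one, one_mul, aeval_add, aeval_mul, aeval_C, aeval_X_pow, aeval_X,
      eq_ratCast, Rat.cast_intCast] at this
    push_cast at this
    linear_combination this
  set β : AlgebraicClosure ℚ := algebraMap ℚ (AlgebraicClosure ℚ) (-406 : ℚ) +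
      algebraMap ℚ (AlgebraicClosure ℚ) (-472 : ℚ) * θ + algebraMap ℚ (AlgebraicClosure ℚ) (130 : ℚ) * θ ^ 2 with hβdef
  have hβ : aeval β (Cubic.toPoly ⟨1, ((0 : ℤ) : ℚ), ((-2357452 : ℤ) : ℚ), ((-1393215376 : ℤ) : ℚ)⟩) = 0 := by
    simp only [Cubic.toPoly, map_one, one_mul, aeval_add, aeval_mul, aeval_C, aeval_X_pow, aeval_X, eq_ratCast,
      Rat.cast_intCast]
    rw [hβdef]
    simp only [eq_ratCast]
    push_cast
    linear_combination ((-50301328 : AlgebraicClosure ℚ) + (57750160 : AlgebraicClosure ℚ) * θ + (-21733400 : AlgebraicClosure ℚ) * θ ^ 2 + (2197000 : AlgebraicClosure ℚ) * θ ^ 3) * hθ'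
  have hadj : IntermediateField.adjoin ℚ {β} = IntermediateField.adjoin ℚ {θ} := by
    apply le_antisymm
    · rw [IntermediateField.adjoin_simple_le_iff, hβdef]
      have hθmem := IntermediateField.mem_adjoin_simple_self ℚ θ
      exact add_mem (add_mem (algebraMap_mem _ _) (mul_mem (algebraMap_mem _ _) hθmem))
        (mul_mem (algebraMap_mem _ _) (pow_mem hθmem 2))
    · rw [IntermediateField.adjoin_simple_le_iff]
      have hθeq : θ = algebraMap ℚ (AlgebraicClosure ℚ) (12799569/90112 : ℚ) +
          algebraMap ℚ (AlgebraicClosure ℚ) (28201/360448 : ℚ) * β +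
          algebraMap ℚ (AlgebraicClosure ℚ) (-65/720896 : ℚ) * β ^ 2 := by
        rw [hβdef]; simp only [eq_ratCast]; push_cast
        linear_combination (((-156325 : AlgebraicClosure ℚ) / 16384) + ((274625 : AlgebraicClosure ℚ) / 180224) * θ) * hθ'
      rw [hθeq]
      have hβmem := IntermediateField.mem_adjoin_simple_self ℚ β
      exact add_mem (add_mem (algebraMap_mem _ _) (mul_mem (algebraMap_mem _ _) hβmem))
        (mul_mem (algebraMap_mem _ _) (pow_mem hβmem 2))
  have h3 : Module.finrank ℚ (IntermediateField.adjoin ℚ {β}) = 3 := by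
    rw [hadj]; exact finrank_adjoin_eq_three_of_irreducible irreducible_cubic_d680n hθ
  exact TotallyComplexMu.conjA_two_cubicModel_of_classicalMu_of_discr_neg (0) (-2357452) (-1393215376)
    (irreducible_cubic_of_finrank_adjoin_eq_three hβ h3) (by simp only [Cubic.discr]; norm_num) hβ
    (by rw [hadj]; exact classicalMu_two_cubicField_d680n hθ) κ hκ
end Summit.BirchSwinnertonDyer.BirchSwinnertonDyer.Theorems.AddKatoTwo

end
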